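import Summits.BirchSwinnertonDyer.BirchSwinnertonDyer.Theorems.KimAtThreeTwoExponentWitnessPairStable
import Summits.BirchSwinnertonDyer.BirchSwinnertonDyer.Theorems.KimAtThreeTwoExponentPortOfZetaBodyU
import HarnessLib

/-!
# Route `KimAtThreeKolyvagin` (rung W2), the `t ≥ 1` additive rows of crux 19679 (`DeepLowerAtThreeOffKatoStratum`,
# stub `stub_additiveDefect`): ★₂-stable — PORT₂ `KatoKuriharaPortThreeAtWith₂TwoExp W t e v₃ η P` AT EVERY `t`
# FROM KATO'S EULER SYSTEM on the rows whose `3`-power torsion over `ℚ₃` is STABLE at level `t`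
# (no `ℚ₃`-point of order `3^{t+1}`), modulo the two-exponent rider and the value rows

Cell `bsd-addord`, seat `bsd-addord-w2-acc3` gen 4 (PROGRAMME PART 1b, plan g16 ACCEL-LIST (3)); `--supports`
stmt-BirchSwinnertonDyer-19679 (helper; the item OWNER assembles).  END-TYPE TOOL THEOREMS WITH DISPLAYED
HYPOTHESES: no definition, no named fact, no instance, no `sorry`; nothing asserted about any curve; nothing booked;
crux 19679 stays OPEN.

## What

This seat's gen-3 ★₂-u / ★₂′-u (`KimAtThreeTwoExponentPortOfZetaBodyU`, p477581) discharge PORT₂ at `t = 0` ONLY: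
THEOREM D's certificate `ht0` (`E(ℚ_w)[3] = 0` over `3`, whence `𝓕_can,3 = ⊤` at every depth, Mazur–Rubin Lemma
A.1).  At `t ≥ 1` the canonical condition at `3` is a PROPER subgroup and the derivative classes meet it only when
they are reductions of DEEPER ones (Mazur–Rubin App. A Prop. A.2: "`H¹_𝓕(ℚ_p, T/𝔪^k T)` is the image of
`H¹(ℚ_p, T/𝔪^j T)` for all sufficiently large `j`"; n1011-p13's T-DER-BP FILE 2 makes `j = k + N₀` explicit, `N₀` a
torsion-stabilisation level of `E(ℚ₃)`; cell memo kim3/KIM3-PROOF.md §14.3 (1a) is the same step with `j = k + t`).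
PORT₂'s With-guard puts the primes of a depth-`k` datum in the Frobenius class of depth `k + t`, i.e. makes them
Kolyvagin primes of level `3^{k+t+1}` — EXACTLY the level this seat's ★★-stable
(`KimAtThreeTwoExponentWitnessPairStable`, on `KimAtThreeDeepLowerKolyvaginPairStable`) asks for when `N₀ = t`.
Hence:

* ★₂-stable `katoKuriharaPortThreeAtWith₂TwoExp_of_zetaBody_of_stable_of_unramified` — ★₂-u with `ht0` REPLACED by
  `hstab` at level `t` (`3^{t+1}·Q = 0 → 3^t·Q = 0` on `E(ℚ_w)`, `w ∣ 3`), the riders (ii₂) and the value rows read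
  at torsion exponent `t`; conclusion `KatoKuriharaPortThreeAtWith₂TwoExp W t e v₃ η P` for every `η`.
* ★₂′-stable `…_of_stable_of_unramified_of_valueRows` — the value rows DISCHARGED by n1011-p02's
  `ValueRow.valueRow_of_zetaBody` at torsion exponent `t` (any `t`).

ROWS SERVED.  `hstab` at level `t` holds on a row with `#E(ℚ₃)[3] = 3^t` iff `E(ℚ₃)` has no point of order
`3^{t+1}`: every `t = 0` row (then this IS ★₂-u), and every `t = 1` row with `E(ℚ₃)[3^∞] ≅ ℤ/3` (T3-CENSUS, kit
j236896: 60 054 + 3 137 of the 63 620 tower rows with `t ≥ 1`); NOT the 429 rows with `E(ℚ₃)[3^∞] ≅ ℤ/9`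
(`#E(ℚ₃)[3] = 3` but `N₀ = 2`), which PORT₂ as typed (guard depth `k + t`) cannot reach by this road.

HONEST LIMITS: riders / `hNorm` are hypotheses on bound witnesses (CONSTRUCTION-SHAPED, never `_holds`; the object
is the dual exponential, `defn-BlochKatoDualExponential`); closes nothing; 0 defs / 0 facts / 0 sorry.  Credit:
seat acc6 gen 2 (★₂/★₂′), seat w2-c3 gen 5/6 (D-u, StableThree), team n1011 (★ PK-6₂, T-DER-BP, value rows);
this seat only re-keys.
References: [Kato2004Asterisque] (8.1.3), §8.2, Lemma 8.5, Prop. 8.12, §9.4, Thm. 9.7, Thm. 6.6 (1), Ex. 13.3;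
[Kim2022StructureSelmer] §2.2.2, §3.2.3, Thm. 3.6, §3.3–§3.4.1, Thm. 3.13; [MazurRubin2004] Def. 3.1.3, Thm. 3.2.4,
App. A (Lemma A.1, Prop. A.2, Remark A.5); [Sakamoto2024] §2, Def. 4.1; [Rubin2000] Def. 4.4.4, Thm. 4.5.1;
[Kim2025RefinedTNC] §4.2, §8.1.2; cell memo kim3/KIM3-PROOF.md §14 (Theorem A-t).
-/

set_option autoImplicit false
-- the Theorems namespace of a single-conjunct summit repeats the summit name by design (D-0017)
set_option linter.dupNamespace false

noncomputable section

open scoped NumberField TensorProduct ContRepresentation Classical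
open CategoryTheory Field Function Finset IsDedekindDomain NumberField WeierstrassCurve
open Rat.HeightOneSpectrum
open Literature.NumberTheory.GaloisRepresentations Literature.NumberTheory.GaloisCohomology
open Literature.NumberTheory.GaloisRepresentations.DiscreteGaloisModule
open Literature.NumberTheory.EllipticCurves Literature.NumberTheory.EllipticCurves.ModularForms
open Literature.NumberTheory.EllipticCurves.Rank1Residual
open Literature.NumberTheory.EllipticCurves.Kato2004
open Literature.NumberTheory.EllipticCurves.Kato2004.EulerSystemValues
open Summit.BirchSwinnertonDyer.Rank1Residual.GaloisImage
open Summit.BirchSwinnertonDyer.BirchSwinnertonDyer.Theorems.KimAtThreeKolyvaginDefs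
open Summit.BirchSwinnertonDyer.BirchSwinnertonDyer.Theorems

namespace Summit.BirchSwinnertonDyer.BirchSwinnertonDyer.Theorems.KimAtThreeTwoExponentPortOfZetaBodyStable


variable (W : WeierstrassCurve ℚ) [W.IsElliptic] [W.IsGloballyMinimal]
  [ContinuousSMul ℤ_[3] (W.tateModule 3)] [Module.Free ℤ_[3] (W.tateModule 3)]
  [Module.Finite ℤ_[3] (W.tateModule 3)]

/-- Local notation: `𝐃F⟦r, τ⟧ ℓ = Σ_{j<ℓ−1} j·σ_{χ_{m(0,r)}(τ_ℓ)}^j` on the level field `ℚ(ζ_{m(0,r)})`. -/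
local notation3 (prettyPrint := false) "𝐃F⟦" r ", " τ "⟧" =>
  fun ℓ : HeightOneSpectrum (𝓞 ℚ) =>
  ∑ j ∈ Finset.range (((primesEquiv ℓ : Nat.Primes) : ℕ) - 1),
    (j : Module.End ℚ (CyclotomicField (cycLevel 3 0 r) ℚ)) *
      (sigma (cycLevel 3 0 r) (modNCyclotomicCharacter ℚ (cycLevel 3 0 r)
          ((τ : HeightOneSpectrum (𝓞 ℚ) → absoluteGaloisGroup ℚ) ℓ)) :
        CyclotomicField (cycLevel 3 0 r) ℚ →ₐ[ℚ] CyclotomicField (cycLevel 3 0 r) ℚ).toLinearMap ^ j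

/-- Local notation: the TWO-EXPONENT rider clause (ii₂) at depth `j`, torsion exponent `t`, defect exponent
`e`, place `v`, for the pair `(Λ, Λf)` (n1011's `KatoExpStarFiniteLevelAt` clause (ii), conclusion `× 3^e`). -/
local notation3 (prettyPrint := false) "RIDER₂⟦" W' ", " j ", " t' ", " e' ", " v' ", " Λ' ", " Λf "⟧" =>
  ∀ (r : Finset (HeightOneSpectrum (𝓞 ℚ)))
    (Ψ : H1 (tateRep W' 3) (cycSubgroup 3 0 r) →+
      continuousCohomology 1
        (subgroupRep (WeierstrassCurve.torsionGaloisModule W' (((3 : ℕ) : ℤ) ^ j * ((3 : ℕ) : ℤ))).toTopRep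
          (cycSubgroup 3 0 r))),
    (∀ (φ : contOneCocycles (subgroupRep (tateRep W' 3).toTopRep (cycSubgroup 3 0 r)))
        (ψ : contOneCocycles
          (subgroupRep (WeierstrassCurve.torsionGaloisModule W' (((3 : ℕ) : ℤ) ^ j * ((3 : ℕ) : ℤ))).toTopRep
            (cycSubgroup 3 0 r))),
        (∀ g, ((ψ.1 g : geomTorsion W' (((3 : ℕ) : ℤ) ^ j * ((3 : ℕ) : ℤ))) : geomPoints W') =
          TateModule.proj 3 (j + 1) (φ.1 g)) →
        Ψ (oneCocycleClass _ φ) = oneCocycleClass _ ψ) →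
    ∀ (y : H1 (tateRep W' 3) (cycSubgroup 3 0 r))
      (κ₀ : galoisCohomology (WeierstrassCurve.torsionGaloisModule W' (((3 : ℕ) : ℤ) ^ j * ((3 : ℕ) : ℤ))) 1)
      (s : ℤ_[3]),
      resSubgroup (WeierstrassCurve.torsionGaloisModule W' (((3 : ℕ) : ℤ) ^ j * ((3 : ℕ) : ℤ))).toTopRep
          (cycSubgroup 3 0 r) 1 κ₀ = Ψ y →
      galoisCohomology.localization (WeierstrassCurve.torsionGaloisModule W' (((3 : ℕ) : ℤ) ^ j * ((3 : ℕ) : ℤ)))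
          (Sum.inr v') 1 κ₀ ∈ propagatedSelmerStructure W' 3 j (Sum.inr v') →
      (∃ l ∈ cycIntLattice 3 (cycLevel 3 0 r),
          (((3 : ℕ) : ℤ_[3]) ^ t') • Λ' 0 r y - ((s : ℚ_[3]) ⊗ₜ[ℚ] (1 : CyclotomicField (cycLevel 3 0 r) ℚ)) =
            (((3 : ℕ) : ℤ_[3]) ^ (j + 1)) • (l : ℚ_[3] ⊗[ℚ] CyclotomicField (cycLevel 3 0 r) ℚ)) →
      ((3 ^ e' : ℕ) : ZMod (3 ^ (j + 1))) *
        Λf (galoisCohomology.localization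
          (WeierstrassCurve.torsionGaloisModule W' (((3 : ℕ) : ℤ) ^ j * ((3 : ℕ) : ℤ))) (Sum.inr v') 1 κ₀) =
        PadicInt.toZModPow (j + 1) s

set_option backward.isDefEq.respectTransparency false in
/-- **★₂-stable: PORT₂ at torsion exponent `t` from Kato's Euler system, THEOREM D-u PAIR-STABLE, the (Λ)-clauses +
two-exponent riders and the value rows — on the rows `3`-torsion-STABLE at level `t` over `3`** (rows with a
`3`-anomalous bad place `w ≠ 3` INCLUDED, NO `hbad`).  Displayed: the parametrisation datum `P` at the conductor level
(`hN`), Kato's witnesses through `hbody` for `P.f`, the functionals `Λfin j` with the (Λ)-clauses `hΛ` and the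
two-exponent scalar compatibilities `hfin₂` (exponent `e`, torsion `t`), `hcdA`, the torsion-stabilisation binder
`hstab` at level `t` over the place(s) of `3` (no `ℚ_w`-point of order `3^{t+1}`), the value rows `hvalue` (at `t`);
concluded: `KatoKuriharaPortThreeAtWith₂TwoExp W t e v₃ η P` for every generator family `η`.  This seat's ★₂-u
(`KimAtThreeTwoExponentPortOfZetaBodyU.katoKuriharaPortThreeAtWith₂TwoExp_zero_of_zetaBody_of_unramified`, p477581)
with `ht0 ↦ hstab`, `0 ↦ t`, the witness pair taken from ★★-stable
(`KimAtThreeTwoExponentWitnessPairStable.exists_katoKuriharaWitnessAtTwoExp_pair_of_zetaBody_of_stable_of_unramified`)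
at `N₀ = t`: the With-guards `IsCanonicalTauDatumThreeAtWith W (k + t) k η` / `… (k′ + t) k′ η` make the primes of
`D` / `D′` Kolyvagin primes of level `3^{k+t+1}` / `3^{k′+t+1}` (E1-deep
`isKolyvaginPrime_of_mem_frobeniusClassPrimes_of_le`), exactly the depth Mazur–Rubin Prop. A.2 needs at the place `3`.
[cite: Kato2004Asterisque, (8.1.3) (p. 180), §9.4 (p. 188), Thm. 9.7 (p. 189) and Ex. 13.3 (pp. 224–225)]
[cite: Kim2022StructureSelmer, Thm. 3.13 and §1.2.2, §2.2.2, §3.2.3, §3.3–§3.4.1 (arXiv v3 pp. 12, 16–18, 26–27)]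
[cite: MazurRubin2004, Def. 3.1.3, Thm. 3.2.4 and App. A (Prop. A.2 pp. 79–80, Remark A.5)] [cite: Sakamoto2024, §2 and Def. 4.1]
[cite: Kim2025RefinedTNC, §4.2 and §8.1.2] -/
theorem katoKuriharaPortThreeAtWith₂TwoExp_of_zetaBody_of_stable_of_unramified
    {N : ℕ} [NeZero N] (P : ModularParametrizationData W N) (hN : N = W.conductorNorm ℤ)
    {ι : (n : ℕ) → (CyclotomicField n ℚ →+* ℂ)} {κK : ℝ}
    {Λ : ∀ (k' : ℕ) (r : Finset (HeightOneSpectrum (𝓞 ℚ))),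
      H1 (tateRep W 3) (cycSubgroup 3 k' r) →ₗ[ℤ_[3]] ℚ_[3] ⊗[ℚ] CyclotomicField (cycLevel 3 k' r) ℚ}
    {c d a : ℤ} {A : ℕ}
    {z : ∀ (k' : ℕ) (r : (cyclotomicLevelsRat 3 (badPlaces c d A N)).Ideals),
      H1 (tateRep W 3) ((cyclotomicLevelsRat 3 (badPlaces c d A N)).level k' r.1)}
    {x : ∀ (k' : ℕ) (r : (cyclotomicLevelsRat 3 (badPlaces c d A N)).Ideals),
      CyclotomicField (cycLevel 3 k' r.1) ℚ}
    (hbody : ZetaBody W 3 P.f ι κK Λ c d a A z x)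
    (t : ℕ) {e : ℕ} {v₃ : HeightOneSpectrum (𝓞 ℚ)}
    (Λfin : ∀ j : ℕ, galoisCohomology ((W.torsionGaloisModule (((3 : ℕ) : ℤ) ^ j * ((3 : ℕ) : ℤ))).toLocal
      (Sum.inr v₃)) 1 →+ ZMod (3 ^ (j + 1)))
    (hΛ : ∀ j : ℕ,
      (∀ c : ZMod (3 ^ (j + 1)), ∃ x ∈ propagatedSelmerStructure W 3 j (Sum.inr v₃), Λfin j x = c) ∧
      (∀ x ∈ propagatedSelmerStructure W 3 j (Sum.inr v₃),
        Λfin j x = 0 ↔ x ∈ W.kummerSelmerStructure (((3 : ℕ) : ℤ) ^ j * ((3 : ℕ) : ℤ)) (Sum.inr v₃)))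
    (hfin₂ : ∀ j : ℕ, RIDER₂⟦W, j, t, e, v₃, Λ, Λfin j⟧)
    {η : (q : HeightOneSpectrum (𝓞 ℚ)) → (ZMod (Ideal.absNorm q.asIdeal))ˣ}
    -- the auxiliary datum avoids every prime `≡ 1 (mod 3)` (so every Kolyvagin prime is usable)
    (hcdA : ∀ q : ℕ, q.Prime → q ≡ 1 [MOD 3] → ¬ q ∣ 2 * c.natAbs * d.natAbs * A)
    -- the `3`-power torsion of `E(ℚ_w)`, `w ∣ 3`, is STABLE at level `t` (no point of order `3^{t+1}`); NO `hbad`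
    (hstab : ∀ w : HeightOneSpectrum (𝓞 ℚ), ((3 : ℕ) : 𝓞 ℚ) ∈ w.asIdeal →
        ∀ Q : (W.baseChange (w.adicCompletion ℚ)).toAffine.Point, 3 ^ (t + 1) • Q = 0 → 3 ^ t • Q = 0)
    -- the per-level VALUE ROWS at torsion exponent `t` (T-PK6-VROW's OUT), displayed
    (hvalue : ∀ (j : ℕ) (σ : HeightOneSpectrum (𝓞 ℚ) → absoluteGaloisGroup ℚ),
      (∀ q, σ q ∈ (adicCompletionPrime ℚ q).inertia (absoluteGaloisGroup ℚ)) →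
      (∀ q, modNCyclotomicCharacter ℚ (Ideal.absNorm q.asIdeal) (σ q) = η q) →
      ∀ (r : Finset (HeightOneSpectrum (𝓞 ℚ)))
        (hr : ∀ q ∈ r, q ∈ (cyclotomicLevelsRat 3 (badPlaces c d A N)).primes),
        (∀ q ∈ r, Kato.IsKolyvaginPrime W 3 (j + 1) ((primesEquiv q : Nat.Primes) : ℕ)) →
        (∀ q ∈ r, Subgroup.zpowers (η q) = ⊤) →
        ∃ (s : ℤ_[3]) (u : (ZMod (3 ^ (j + 1)))ˣ)
          (ψ : (ℓ : ℕ) → (ZMod ℓ)ˣ →* Multiplicative (ZMod (3 ^ (j + 1)))),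
          (∀ q ∈ r, Function.Surjective (ψ (Ideal.absNorm q.asIdeal))) ∧
          (∃ l ∈ cycIntLattice 3 (cycLevel 3 0 r),
            (((3 : ℕ) : ℤ_[3]) ^ t) • ((1 : ℚ_[3]) ⊗ₜ[ℚ]
              ((r.noncommProd 𝐃F⟦r, σ⟧ (ZetaValue.pairwise_commute_fieldDeriv (cycLevel 3 0 r)
                  (fun ℓ => modNCyclotomicCharacter ℚ (cycLevel 3 0 r) (σ ℓ))
                  (fun ℓ => ((primesEquiv ℓ : Nat.Primes) : ℕ) - 1) r))
                (x 0 ⟨r, hr⟩ + sigma (cycLevel 3 0 r) (-1) (x 0 ⟨r, hr⟩)))) -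
              ((s : ℚ_[3]) ⊗ₜ[ℚ] (1 : CyclotomicField (cycLevel 3 0 r) ℚ)) =
            (((3 : ℕ) : ℤ_[3]) ^ (j + 1)) • (l : ℚ_[3] ⊗[ℚ] CyclotomicField (cycLevel 3 0 r) ℚ)) ∧
          haveI : NeZero (∏ q ∈ r, Ideal.absNorm q.asIdeal) :=
            ⟨Finset.prod_ne_zero_iff.2 fun q _ h => q.ne_bot (Ideal.absNorm_eq_zero_iff.1 h)⟩
          PadicInt.toZModPow (j + 1) s = (u : ZMod (3 ^ (j + 1))) *
            ((3 : ℕ) : ZMod (3 ^ (j + 1))) ^ t *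
              kuriharaNumber P.f (3 ^ (j + 1)) (∏ q ∈ r, Ideal.absNorm q.asIdeal) ψ) :
    KatoKuriharaPortThreeAtWith₂TwoExp W t e v₃ η P := by
  intro k k' D D' red hDW hDW' hkk' hred _hadd hsurj _ht hv₃
  -- the guards
  obtain ⟨hT, hC, S, τ, hS, hτμ, hτq, hP⟩ := hDW
  obtain ⟨hT', hC', S', τ', hS', hτμ', hτq', hP'⟩ := hDW'
  have hirr : W.HasIrreducibleModPGaloisRep 3 :=
    hasIrreducibleModPGaloisRep_of_hasSurjectiveModNGaloisRep W 3 hsurj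
  -- Kolyvagin primes of levels `k + t + 1`, `k′ + t + 1` (E1-deep on the deep classes of the With-guards: this is
  -- where the guard depth `k + t` pays for the place `3`)
  have hKol : ∀ q ∈ D.primes, Kato.IsKolyvaginPrime W 3 (k + t + 1) ((primesEquiv q : Nat.Primes) : ℕ) :=
    fun q hq => KolyvaginPrime.isKolyvaginPrime_of_mem_frobeniusClassPrimes_of_le W
      (le_refl (k + t)) (fun v hv => (hS v hv).1) hτμ hτq (hP hq)
  have hKol' : ∀ q ∈ D'.primes, Kato.IsKolyvaginPrime W 3 (k' + t + 1) ((primesEquiv q : Nat.Primes) : ℕ) :=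
    fun q hq => KolyvaginPrime.isKolyvaginPrime_of_mem_frobeniusClassPrimes_of_le W
      (le_refl (k' + t)) (fun v hv => (hS' v hv).1) hτμ' hτq' (hP' hq)
  -- every Kolyvagin prime is a usable prime of Kato's system for `(c, d, A, N)`
  have husable : ∀ (j : ℕ) (q : HeightOneSpectrum (𝓞 ℚ)),
      Kato.IsKolyvaginPrime W 3 (j + 1) ((primesEquiv q : Nat.Primes) : ℕ) →
        q ∈ (cyclotomicLevelsRat 3 (badPlaces c d A N)).primes := by
    intro j q hq
    have hℓ := hq.prime
    have h13 : ((primesEquiv q : Nat.Primes) : ℕ) ≡ 1 [MOD 3] :=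
      hq.modEq_one.of_dvd (dvd_pow_self 3 (Nat.succ_ne_zero j))
    refine (mem_primes_cyclotomicLevelsRat_badPlaces_iff 3 c d A N q).2 ⟨fun hdvd => ?_, hq.ne⟩
    rcases (Nat.Prime.dvd_mul hℓ).mp hdvd with h | h
    · exact hcdA _ hℓ h13 h
    · apply hq.not_dvd
      rw [← hN]
      exact dvd_mul_of_dvd_left h 3
  have hPr : D.primes ⊆ (cyclotomicLevelsRat 3 (badPlaces c d A N)).primes :=
    fun q hq => husable (k + t) q (hKol q hq)
  have hPr' : D'.primes ⊆ (cyclotomicLevelsRat 3 (badPlaces c d A N)).primes :=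
    fun q hq => husable (k' + t) q (hKol' q hq)
  -- the torsion-stabilisation binder in THEOREM D-u PAIR-STABLE's currency (`primesEquiv w = 3`)
  have hstab' : ∀ w : HeightOneSpectrum (𝓞 ℚ), ((primesEquiv w : Nat.Primes) : ℕ) = 3 →
      ∀ Q : (W.baseChange (w.adicCompletion ℚ)).toAffine.Point, 3 ^ (t + 1) • Q = 0 → 3 ^ t • Q = 0 :=
    fun w hw => hstab w (KolyvaginPrime.natCast_mem_asIdeal_of_primesEquiv_eq hw)
  -- the two-exponent witness package at the two depths + (COMP) (★★-stable at `N₀ = t`), value rows from `hvalue`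
  obtain ⟨κf, κu, h₁, h₂, h₃⟩ :=
    KimAtThreeTwoExponentWitnessPairStable.exists_katoKuriharaWitnessAtTwoExp_pair_of_zetaBody_of_stable_of_unramified
      W P hbody hirr hkk' red hred hv₃ (hΛ k) (hΛ k') (hfin₂ k) (hfin₂ k') D hT D' hT' hC hC' hPr hPr'
      hstab' hKol hKol'
      (fun σ hI hχ r hr => hvalue k σ hI hχ r (fun q hq => hPr (hr (Finset.mem_coe.2 hq)))
        (fun q hq => (hKol q (hr (Finset.mem_coe.2 hq))).mono (by omega))
        (fun q hq => hC.zpowers_eq_top (hr (Finset.mem_coe.2 hq))))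
      (fun σ hI hχ r hr => hvalue k' σ hI hχ r (fun q hq => hPr' (hr (Finset.mem_coe.2 hq)))
        (fun q hq => (hKol' q (hr (Finset.mem_coe.2 hq))).mono (by omega))
        (fun q hq => hC'.zpowers_eq_top (hr (Finset.mem_coe.2 hq))))
  exact ⟨κf, Λfin k, κf, κu, Λfin k', κu, h₁, h₂, fun l hl' hl => ⟨h₃ l hl' hl, h₃ l hl' hl⟩⟩

/-- **★₂′-stable: ★₂-stable with the value rows DISCHARGED** — PORT₂ `KatoKuriharaPortThreeAtWith₂TwoExp W t e v₃ η P`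
from `ZetaBody` (displayed `hbody`), the (Λ)-clauses `hΛ`, the two-exponent riders `hfin₂` at torsion exponent `t`,
`hcdA`, the torsion-stabilisation binder `hstab` at level `t` over `3` (NO `hbad`, NO `ht0`), and the level-free VALUE
certificates of n1011's T-PK6-VDIS (`hirr`, `hNorm`/`hκ0`, `d′`/`hcd`/`hdd′`, `hAN`, `hpN`, `aM`/`haM`, `hE0`/`hE`,
`hR0`/`hR`) — ★₂-stable ∘ `ValueRow.valueRow_of_zetaBody` (at torsion exponent `t`).  This seat's ★₂′-u (p477581)
with `ht0 ↦ hstab`, `0 ↦ t`.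
[cite: Kato2004Asterisque, §9.4 (p. 188), Thm. 9.7 (p. 189), Thm. 6.6 (1) (p. 163) and Ex. 13.3 (pp. 224–225)]
[cite: Kim2022StructureSelmer, Thm. 3.13 and its proof (arXiv v3 pp. 12, 26–28)]
[cite: MazurRubin2004, App. A Prop. A.2 (pp. 79–80)] [cite: Kim2025RefinedTNC, §4.2 and §8.1.2] -/
theorem katoKuriharaPortThreeAtWith₂TwoExp_of_zetaBody_of_stable_of_unramified_of_valueRows
    {N : ℕ} [NeZero N] (P : ModularParametrizationData W N) (hN : N = W.conductorNorm ℤ)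
    {ι : (n : ℕ) → (CyclotomicField n ℚ →+* ℂ)} {κK : ℝ}
    {Λ : ∀ (k' : ℕ) (r : Finset (HeightOneSpectrum (𝓞 ℚ))),
      H1 (tateRep W 3) (cycSubgroup 3 k' r) →ₗ[ℤ_[3]] ℚ_[3] ⊗[ℚ] CyclotomicField (cycLevel 3 k' r) ℚ}
    {c d a : ℤ} {A : ℕ} [NeZero A]
    {z : ∀ (k' : ℕ) (r : (cyclotomicLevelsRat 3 (badPlaces c d A N)).Ideals),
      H1 (tateRep W 3) ((cyclotomicLevelsRat 3 (badPlaces c d A N)).level k' r.1)}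
    {x : ∀ (k' : ℕ) (r : (cyclotomicLevelsRat 3 (badPlaces c d A N)).Ideals),
      CyclotomicField (cycLevel 3 k' r.1) ℚ}
    (hbody : ZetaBody W 3 P.f ι κK Λ c d a A z x)
    (t : ℕ) {e : ℕ} {v₃ : HeightOneSpectrum (𝓞 ℚ)}
    (Λfin : ∀ j : ℕ, galoisCohomology ((W.torsionGaloisModule (((3 : ℕ) : ℤ) ^ j * ((3 : ℕ) : ℤ))).toLocal
      (Sum.inr v₃)) 1 →+ ZMod (3 ^ (j + 1)))
    (hΛ : ∀ j : ℕ,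
      (∀ c : ZMod (3 ^ (j + 1)), ∃ x ∈ propagatedSelmerStructure W 3 j (Sum.inr v₃), Λfin j x = c) ∧
      (∀ x ∈ propagatedSelmerStructure W 3 j (Sum.inr v₃),
        Λfin j x = 0 ↔ x ∈ W.kummerSelmerStructure (((3 : ℕ) : ℤ) ^ j * ((3 : ℕ) : ℤ)) (Sum.inr v₃)))
    (hfin₂ : ∀ j : ℕ, RIDER₂⟦W, j, t, e, v₃, Λ, Λfin j⟧)
    {η : (q : HeightOneSpectrum (𝓞 ℚ)) → (ZMod (Ideal.absNorm q.asIdeal))ˣ}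
    (hcdA : ∀ q : ℕ, q.Prime → q ≡ 1 [MOD 3] → ¬ q ∣ 2 * c.natAbs * d.natAbs * A)
    (hstab : ∀ w : HeightOneSpectrum (𝓞 ℚ), ((3 : ℕ) : 𝓞 ℚ) ∈ w.asIdeal →
        ∀ Q : (W.baseChange (w.adicCompletion ℚ)).toAffine.Point, 3 ^ (t + 1) • Q = 0 → 3 ^ t • Q = 0)
    -- the VALUE certificates (T-PK6-VDIS), replacing ★₂-stable's displayed `hvalue`
    (hirr : W.HasIrreducibleModPGaloisRep 3)
    (hNorm : ∃ u : ℚ, (u : ℝ) = κK ∧ padicValRat 3 u = 0) (hκ0 : κK ≠ 0)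
    (d' : ℤ) (hcd : Int.gcd (c * d) A = 1) (hdd' : d * d' ≡ 1 [ZMOD (A : ℤ)])
    (hAN : Nat.Coprime A N) (hpN : 3 ^ 2 ∣ N)
    (aM : ℕ → ℤ) (haM : ∀ q ∈ (3 * A).primeFactors, cuspCoeff P.f q = aM q)
    (hE0 : ∏ q ∈ (3 * A).primeFactors, (1 - (aM q : ℚ) / q + (if q ∣ N then 0 else (1 / q : ℚ))) ≠ 0)
    (hE : padicValRat 3
      (∏ q ∈ (3 * A).primeFactors, (1 - (aM q : ℚ) / q + (if q ∣ N then 0 else (1 / q : ℚ)))) = 0)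
    (hR0 : (c : ℚ) ^ 2 * (d : ℚ) ^ 2 * ratMinusSymbol P.f ((a : ℚ) / A) -
        (c : ℚ) * (d : ℚ) ^ 2 * ratMinusSymbol P.f ((a * c : ℚ) / A) -
        (c : ℚ) ^ 2 * (d : ℚ) * ratMinusSymbol P.f ((a * d' : ℚ) / A) +
        (c : ℚ) * (d : ℚ) * ratMinusSymbol P.f ((a * c * d' : ℚ) / A) ≠ 0)
    (hR : padicValRat 3 ((c : ℚ) ^ 2 * (d : ℚ) ^ 2 * ratMinusSymbol P.f ((a : ℚ) / A) -
        (c : ℚ) * (d : ℚ) ^ 2 * ratMinusSymbol P.f ((a * c : ℚ) / A) -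
        (c : ℚ) ^ 2 * (d : ℚ) * ratMinusSymbol P.f ((a * d' : ℚ) / A) +
        (c : ℚ) * (d : ℚ) * ratMinusSymbol P.f ((a * c * d' : ℚ) / A)) = 0) :
    KatoKuriharaPortThreeAtWith₂TwoExp W t e v₃ η P :=
  katoKuriharaPortThreeAtWith₂TwoExp_of_zetaBody_of_stable_of_unramified W P hN hbody t Λfin hΛ hfin₂ hcdA hstab
    (fun j σ hσI hσχ r hr hKolr hη =>
      ValueRow.valueRow_of_zetaBody hbody P.isNewformOf (by decide) hirr hNorm hκ0 d' hcd hdd' hAN hpN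
        aM haM hE0 hE hR0 hR η j t σ hσI hσχ r hr hKolr hη)

end Summit.BirchSwinnertonDyer.BirchSwinnertonDyer.Theorems.KimAtThreeTwoExponentPortOfZetaBodyStable

end
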